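import Summits.CriticalPhenomena.PercolationContinuityZ3.Theorems.PercNearOneGluingNoHeavyLowerTailSahiOneStepSubblockThreshold
import Summits.CriticalPhenomena.PercolationContinuityZ3.Theorems.PercNearOneGluingNoHeavyLowerTailSahiOneStepTwoChainFuzzy
import HarnessLib

/-!
# One-step scheme: `(2′)` and Kahn C5 / Sahi `C₃` whenever one event is measurable w.r.t. TWO BLOCK COUNTS (THEOREM B)

Prover prim-ineq-prove-3 gen 24 (`--supports stmt-CriticalPhenomena-4575`; memo `run/shared/lean/prim/prim-ineq-prove-3/FINDING-G24-TWO-CHAIN.md`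
§0(iii)).  No definitions, no named facts, no sorries, no `native_decide`.

Gen 20's THEOREM A (`…SubblockThreshold.osN_subblockThreshold_nonneg`) proved hypothesis `(2′)` of the one-step scheme for the pairs
(`U`, `{N_T ≥ r}`) with `U` an arbitrary increasing event.  Using the TWO-CHAIN COLLAPSE THEOREM (`…TwoChainFuzzy.grid_collapse_cells`,
this generation) in place of the one-dimensional grid theorem, the sub-block threshold is replaced by ANY event of the form
`B = {ω : P (N_T ω) (N_{F∖T} ω)}` with `P` monotone in both counts — e.g. `{N_T ≥ r} ∩ {N_{F∖T} ≥ r'}`, `{N_T ≥ r} ∪ {N_{F∖T} ≥ r'}`,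
two-weight weighted majorities `{w·N_T + w'·N_{F∖T} ≥ θ}`.
* `osN_twoBlock_nonneg` — `0 ≤ osN p {N_F ≥ t} 1_U 1_B` for every product measure, `T ⊆ F`, every `t`, every increasing `U`;
* `sahiE3_threshold_twoBlock_nonneg` (+ slot-exchanged form) — `0 ≤ E₃(1_{N_F ≥ t}, 1_U, 1_B)`.
-/

noncomputable section

namespace Summit.CriticalPhenomena.PercolationContinuityZ3.Theorems

namespace SahiOneStep

open MeasureTheory Finset
open Literature.Probability.Percolation (DeterminedBy determinedBy_iff prodBernoulli_real_eq_sum_weight_ind)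
open Literature.Probability.LatticeModels (prodBernoulli sahiE3 prodBernoulli_real_inter_of_determinedBy_disjoint)
open Literature.Probability.Percolation.DecisionTree (ind ind_of_mem ind_of_not_mem ind_nonneg)
open Literature.Probability.Percolation.BHK2006 (weight weight_nonneg)
open scoped Classical

variable {ι : Type*} [Fintype ι] [DecidableEq ι]

/-! ## The two-chain grid theorem in `H`-form -/

/-- The conclusion of `TwoChain.grid_collapse_cells` rewritten with `H = {t ≤ k+j}`-sums (the shape of `osN_ind_ind`). [this work] -/
theorem grid_collapse_cells_Hform (K J : ℕ) (a b : ℕ → ℝ) (u : ℕ → ℕ → ℝ) (PB : ℕ → ℕ → Prop) (t : ℕ)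
    (ha : ∀ k, 0 ≤ a k) (hb : ∀ j, 0 ≤ b j) (hu : ∀ k j, 0 ≤ u k j) (hub : ∀ k j, u k j ≤ a k * b j)
    (F1 : ∀ k k' j, k ≤ k' → u k j * a k' ≤ u k' j * a k) (F2 : ∀ k j j', j ≤ j' → u k j * b j' ≤ u k j' * b j)
    (hA1 : ∑ k ∈ range (K + 1), a k = 1) (hB1 : ∑ j ∈ range (J + 1), b j = 1)
    (hPBk : ∀ k k' j, k ≤ k' → PB k j → PB k' j) (hPBj : ∀ k j j', j ≤ j' → PB k j → PB k j') :
    0 ≤ (∑ k ∈ range (K + 1), ∑ j ∈ range (J + 1), if t ≤ k + j then u k j else 0) *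
          (∑ k ∈ range (K + 1), ∑ j ∈ range (J + 1), if t ≤ k + j ∧ PB k j then a k * b j else 0)
        + (1 - ∑ k ∈ range (K + 1), ∑ j ∈ range (J + 1), if t ≤ k + j then a k * b j else 0) *
          (∑ k ∈ range (K + 1), ∑ j ∈ range (J + 1), if t ≤ k + j ∧ PB k j then u k j else 0)
        + (∑ k ∈ range (K + 1), ∑ j ∈ range (J + 1), if t ≤ k + j then a k * b j else 0) *
          (∑ k ∈ range (K + 1), ∑ j ∈ range (J + 1), u k j) *
          (∑ k ∈ range (K + 1), ∑ j ∈ range (J + 1), if PB k j then a k * b j else 0)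
        - (∑ k ∈ range (K + 1), ∑ j ∈ range (J + 1), if t ≤ k + j then u k j else 0) *
          (∑ k ∈ range (K + 1), ∑ j ∈ range (J + 1), if PB k j then a k * b j else 0)
        - (∑ k ∈ range (K + 1), ∑ j ∈ range (J + 1), if t ≤ k + j ∧ PB k j then a k * b j else 0) *
          (∑ k ∈ range (K + 1), ∑ j ∈ range (J + 1), u k j) := by
  have hgrid := TwoChain.grid_collapse_cells K J t a b u PB ha hb hu hub F1 F2 hA1 hB1 hPBk hPBj
  -- relate `H`-sums and `L`-sums
  have eSU : (∑ k ∈ range (K + 1), ∑ j ∈ range (J + 1), u k j) =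
      (∑ k ∈ range (K + 1), ∑ j ∈ range (J + 1), if t ≤ k + j then u k j else 0) +
        (∑ k ∈ range (K + 1), ∑ j ∈ range (J + 1), if k + j < t then u k j else 0) := by
    have h1 : (∑ k ∈ range (K + 1), ∑ j ∈ range (J + 1), u k j) =
        ∑ k ∈ range (K + 1), ∑ j ∈ range (J + 1), if True then u k j else 0 := by simp
    rw [h1, dsum_split (K + 1) (J + 1) (fun _ _ => True) (fun k j => t ≤ k + j)]
    congr 1
    · exact Finset.sum_congr rfl fun k _ => Finset.sum_congr rfl fun j _ => by simp
    · exact Finset.sum_congr rfl fun k _ => Finset.sum_congr rfl fun j _ => by simp only [true_and, not_le]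
  have eM : (1 : ℝ) =
      (∑ k ∈ range (K + 1), ∑ j ∈ range (J + 1), if t ≤ k + j then a k * b j else 0) +
        (∑ k ∈ range (K + 1), ∑ j ∈ range (J + 1), if k + j < t then a k * b j else 0) := by
    have h0 : (1 : ℝ) = ∑ k ∈ range (K + 1), ∑ j ∈ range (J + 1), if True then a k * b j else 0 := by
      simp only [if_true]; rw [← Finset.sum_mul_sum, hA1, hB1, mul_one]
    rw [h0, dsum_split (K + 1) (J + 1) (fun _ _ => True) (fun k j => t ≤ k + j)]
    congr 1
    · exact Finset.sum_congr rfl fun k _ => Finset.sum_congr rfl fun j _ => by simp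
    · exact Finset.sum_congr rfl fun k _ => Finset.sum_congr rfl fun j _ => by simp only [true_and, not_le]
  have eMB : (∑ k ∈ range (K + 1), ∑ j ∈ range (J + 1), if PB k j then a k * b j else 0) =
      (∑ k ∈ range (K + 1), ∑ j ∈ range (J + 1), if t ≤ k + j ∧ PB k j then a k * b j else 0) +
        (∑ k ∈ range (K + 1), ∑ j ∈ range (J + 1), if k + j < t ∧ PB k j then a k * b j else 0) := by
    rw [dsum_split (K + 1) (J + 1) (fun k j => PB k j) (fun k j => t ≤ k + j)]
    congr 1
    · refine Finset.sum_congr rfl fun k _ => Finset.sum_congr rfl fun j _ => ?_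
      by_cases h1 : PB k j <;> by_cases h2 : t ≤ k + j <;> simp [h1, h2]
    · refine Finset.sum_congr rfl fun k _ => Finset.sum_congr rfl fun j _ => ?_
      by_cases h1 : PB k j <;> by_cases h2 : t ≤ k + j
      all_goals first
        | (have h3 : ¬ k + j < t := by omega
           simp [h1, h2, h3])
        | (have h3 : k + j < t := by omega
           simp [h1, h2, h3])
  have eUB : (∑ k ∈ range (K + 1), ∑ j ∈ range (J + 1), if t ≤ k + j ∧ PB k j then u k j else 0) =
      (∑ k ∈ range (K + 1), ∑ j ∈ range (J + 1), if PB k j then u k j else 0) -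
        (∑ k ∈ range (K + 1), ∑ j ∈ range (J + 1), if k + j < t ∧ PB k j then u k j else 0) := by
    rw [dsum_split (K + 1) (J + 1) (fun k j => PB k j) (fun k j => t ≤ k + j)]
    have e1 : (∑ k ∈ range (K + 1), ∑ j ∈ range (J + 1), if PB k j ∧ t ≤ k + j then u k j else 0) =
        ∑ k ∈ range (K + 1), ∑ j ∈ range (J + 1), if t ≤ k + j ∧ PB k j then u k j else 0 :=
      Finset.sum_congr rfl fun k _ => Finset.sum_congr rfl fun j _ => by
        by_cases h1 : PB k j <;> by_cases h2 : t ≤ k + j <;> simp [h1, h2]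
    have e2 : (∑ k ∈ range (K + 1), ∑ j ∈ range (J + 1), if PB k j ∧ ¬ t ≤ k + j then u k j else 0) =
        ∑ k ∈ range (K + 1), ∑ j ∈ range (J + 1), if k + j < t ∧ PB k j then u k j else 0 :=
      Finset.sum_congr rfl fun k _ => Finset.sum_congr rfl fun j _ => by
        by_cases h1 : PB k j <;> by_cases h2 : t ≤ k + j
        all_goals first
          | (have h3 : ¬ k + j < t := by omega
             simp [h1, h2, h3])
          | (have h3 : k + j < t := by omega
             simp [h1, h2, h3])
    rw [e1, e2]; ring
  -- unused but harmless: the `H ∩ B`-part of `u` in `L`-form is not needed; express everything and conclude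
  have eML : (∑ k ∈ range (K + 1), ∑ j ∈ range (J + 1), if k + j < t then a k * b j else 0) =
      1 - ∑ k ∈ range (K + 1), ∑ j ∈ range (J + 1), if t ≤ k + j then a k * b j else 0 := by linarith
  rw [eSU, eMB, eML] at hgrid
  rw [eSU, eMB]
  nlinarith [hgrid, eUB]

/-! ## THEOREM B: `(2′)` whenever the second event is measurable w.r.t. `(N_T, N_{F∖T})` -/

/-- **`(2′)` FOR TWO-BLOCK-MEASURABLE EVENTS.**  For every product measure, every block `F`, every `T ⊆ F`, every `t`, every predicate `P`
on pairs of counts that is monotone in each count, and EVERY increasing event `U`: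
`0 ≤ n(1_U, 1_B)` for `B = {ω : P (N_T ω) (N_{F∖T} ω)}` and the first slot `H = {N_F ≥ t}`. [this work] -/
theorem osN_twoBlock_nonneg (p : ι → unitInterval) (F : Finset ι) {T : Finset ι} (hTF : T ⊆ F) (t : ℕ)
    (P : ℕ → ℕ → Prop) (hPk : ∀ k k' j, k ≤ k' → P k j → P k' j) (hPj : ∀ k j j', j ≤ j' → P k j → P k j')
    {U : Set (Set ι)} (hU : IsUpperSet U) :
    0 ≤ osN p {ω : Set ι | t ≤ (F.filter (· ∈ ω)).card} (ind U)
      (ind {ω : Set ι | P (T.filter (· ∈ ω)).card ((F \ T).filter (· ∈ ω)).card}) := by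
  set R : Finset ι := F \ T with hR
  have hTR : Disjoint T R := Finset.disjoint_sdiff
  set H : Set (Set ι) := {ω : Set ι | t ≤ (F.filter (· ∈ ω)).card} with hH
  set B : Set (Set ι) := {ω : Set ι | P (T.filter (· ∈ ω)).card (R.filter (· ∈ ω)).card} with hB
  -- grid data
  obtain ⟨a, ha⟩ : ∃ a : ℕ → ℝ, ∀ k, a k = (prodBernoulli p).real {ω' : Set ι | (T.filter (· ∈ ω')).card = k} := ⟨_, fun _ => rfl⟩
  obtain ⟨b, hb⟩ : ∃ b : ℕ → ℝ, ∀ j, b j = (prodBernoulli p).real {ω' : Set ι | (R.filter (· ∈ ω')).card = j} := ⟨_, fun _ => rfl⟩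
  obtain ⟨u, hu⟩ : ∃ u : ℕ → ℕ → ℝ, ∀ k j, u k j = (prodBernoulli p).real
      (U ∩ {ω' : Set ι | (R.filter (· ∈ ω')).card = j} ∩ {ω' : Set ι | (T.filter (· ∈ ω')).card = k}) := ⟨_, fun _ _ => rfl⟩
  have ha0 : ∀ k, 0 ≤ a k := fun k => by rw [ha]; exact measureReal_nonneg
  have hb0 : ∀ j, 0 ≤ b j := fun j => by rw [hb]; exact measureReal_nonneg
  have hu0 : ∀ k j, 0 ≤ u k j := fun k j => by rw [hu]; exact measureReal_nonneg
  have hcell : ∀ k j, (prodBernoulli p).real (Set.univ ∩ {ω' : Set ι | (R.filter (· ∈ ω')).card = j} ∩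
      {ω' : Set ι | (T.filter (· ∈ ω')).card = k}) = a k * b j := fun k j => by
    rw [ha, hb]; exact real_cell_eq_mul p hTR k j
  have hub : ∀ k j, u k j ≤ a k * b j := fun k j => by
    rw [hu, ← hcell]
    exact measureReal_mono (Set.inter_subset_inter_left _ (Set.inter_subset_inter_left _ (Set.subset_univ U)))
  have F1 : ∀ k k' j, k ≤ k' → u k j * a k' ≤ u k' j * a k := fun k k' j hkk' => by
    rw [hu, hu, ha, ha]
    exact real_inter_inter_layer_mul_le p T hU
      ((determinedBy_layer R j).mono (fun i hi => Finset.disjoint_left.1 hTR.symm (Finset.mem_coe.1 hi))) hkk'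
  have F2 : ∀ k j j', j ≤ j' → u k j * b j' ≤ u k j' * b j := fun k j j' hjj' => by
    rw [hu, hu, hb, hb, Set.inter_right_comm U, Set.inter_right_comm U _ {ω' : Set ι | (T.filter (· ∈ ω')).card = k}]
    exact real_inter_inter_layer_mul_le p R hU
      ((determinedBy_layer T k).mono (fun i hi => Finset.disjoint_left.1 hTR (Finset.mem_coe.1 hi))) hjj'
  have hA1 : ∑ k ∈ range (T.card + 1), a k = 1 := by
    rw [Finset.sum_congr rfl fun k _ => ha k]; exact sum_real_layer_eq_one p T
  have hB1 : ∑ j ∈ range (R.card + 1), b j = 1 := by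
    rw [Finset.sum_congr rfl fun j _ => hb j]; exact sum_real_layer_eq_one p R
  have hgrid := grid_collapse_cells_Hform T.card R.card a b u P t ha0 hb0 hu0 hub F1 F2 hA1 hB1 hPk hPj
  -- membership in `H`, `B` on a cell
  have memH : ∀ ω : Set ι, ∀ k j, (T.filter (· ∈ ω)).card = k → (R.filter (· ∈ ω)).card = j → (ω ∈ H ↔ t ≤ k + j) := by
    intro ω k j hk hj
    rw [hH, Set.mem_setOf_eq, card_filter_mem_eq_add F hTF ω, hk, ← hR, hj]
  have memB : ∀ ω : Set ι, ∀ k j, (T.filter (· ∈ ω)).card = k → (R.filter (· ∈ ω)).card = j → (ω ∈ B ↔ P k j) := by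
    intro ω k j hk hj
    rw [hB, Set.mem_setOf_eq, hk, hj]
  -- the six measures as grid sums
  have eHU : (prodBernoulli p).real (H ∩ U) = ∑ k ∈ range (T.card + 1), ∑ j ∈ range (R.card + 1),
      if t ≤ k + j then u k j else 0 := by
    rw [real_eq_sum_cells p T R]
    refine Finset.sum_congr rfl fun k _ => Finset.sum_congr rfl fun j _ => ?_
    rw [hu]
    exact real_inter_cell_eq_ite p T R (C := H ∩ U) (V := U) (P := t ≤ k + j) fun ω hk hj => by
      rw [Set.mem_inter_iff, memH ω k j hk hj]
  have eHB : (prodBernoulli p).real (H ∩ B) = ∑ k ∈ range (T.card + 1), ∑ j ∈ range (R.card + 1),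
      if t ≤ k + j ∧ P k j then a k * b j else 0 := by
    rw [real_eq_sum_cells p T R]
    refine Finset.sum_congr rfl fun k _ => Finset.sum_congr rfl fun j _ => ?_
    rw [← hcell]
    exact real_inter_cell_eq_ite p T R (C := H ∩ B) (V := Set.univ) (P := t ≤ k + j ∧ P k j) fun ω hk hj => by
      rw [Set.mem_inter_iff, memH ω k j hk hj, memB ω k j hk hj]; simp
  have eH : (prodBernoulli p).real H = ∑ k ∈ range (T.card + 1), ∑ j ∈ range (R.card + 1),
      if t ≤ k + j then a k * b j else 0 := by
    rw [real_eq_sum_cells p T R]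
    refine Finset.sum_congr rfl fun k _ => Finset.sum_congr rfl fun j _ => ?_
    rw [← hcell]
    exact real_inter_cell_eq_ite p T R (C := H) (V := Set.univ) (P := t ≤ k + j) fun ω hk hj => by
      rw [memH ω k j hk hj]; simp
  have eHUB : (prodBernoulli p).real (H ∩ U ∩ B) = ∑ k ∈ range (T.card + 1), ∑ j ∈ range (R.card + 1),
      if t ≤ k + j ∧ P k j then u k j else 0 := by
    rw [real_eq_sum_cells p T R]
    refine Finset.sum_congr rfl fun k _ => Finset.sum_congr rfl fun j _ => ?_
    rw [hu]
    exact real_inter_cell_eq_ite p T R (C := H ∩ U ∩ B) (V := U) (P := t ≤ k + j ∧ P k j) fun ω hk hj => by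
      rw [Set.mem_inter_iff, Set.mem_inter_iff, memH ω k j hk hj, memB ω k j hk hj]; tauto
  have eU : (prodBernoulli p).real U = ∑ k ∈ range (T.card + 1), ∑ j ∈ range (R.card + 1), u k j := by
    rw [real_eq_sum_cells p T R]
    exact Finset.sum_congr rfl fun k _ => Finset.sum_congr rfl fun j _ => (hu k j).symm
  have eB : (prodBernoulli p).real B = ∑ k ∈ range (T.card + 1), ∑ j ∈ range (R.card + 1),
      if P k j then a k * b j else 0 := by
    rw [real_eq_sum_cells p T R]
    refine Finset.sum_congr rfl fun k _ => Finset.sum_congr rfl fun j _ => ?_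
    rw [← hcell]
    exact real_inter_cell_eq_ite p T R (C := B) (V := Set.univ) (P := P k j) fun ω hk hj => by
      rw [memB ω k j hk hj]; simp
  rw [osN_ind_ind, eHU, eHB, eH, eHUB, eU, eB]
  exact hgrid

omit [Fintype ι] [DecidableEq ι] in
/-- A two-block-measurable event with a monotone predicate is increasing. [folklore] -/
theorem isUpperSet_twoBlock (T R : Finset ι) (P : ℕ → ℕ → Prop) (hPk : ∀ k k' j, k ≤ k' → P k j → P k' j)
    (hPj : ∀ k j j', j ≤ j' → P k j → P k j') :
    IsUpperSet {ω : Set ι | P (T.filter (· ∈ ω)).card (R.filter (· ∈ ω)).card} := by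
  intro ω ω' hle hω
  simp only [Set.mem_setOf_eq] at hω ⊢
  have h1 : (T.filter (· ∈ ω)).card ≤ (T.filter (· ∈ ω')).card :=
    Finset.card_le_card fun i hi => by rw [Finset.mem_filter] at hi ⊢; exact ⟨hi.1, hle hi.2⟩
  have h2 : (R.filter (· ∈ ω)).card ≤ (R.filter (· ∈ ω')).card :=
    Finset.card_le_card fun i hi => by rw [Finset.mem_filter] at hi ⊢; exact ⟨hi.1, hle hi.2⟩
  exact hPj _ _ _ h2 (hPk _ _ _ h1 hω)

/-- **KAHN C5 / SAHI `C₃` FOR A HAMMING THRESHOLD, A TWO-BLOCK-MEASURABLE EVENT AND AN ARBITRARY INCREASING EVENT.**  For every product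
measure, all `T ⊆ F`, every `t`, every predicate `P` monotone in each count and every increasing `U`:
`0 ≤ E₃(1_{N_F ≥ t}, 1_U, 1_{P(N_T, N_{F∖T})})`. [this work] -/
theorem sahiE3_threshold_twoBlock_nonneg (p : ι → unitInterval) (F : Finset ι) {T : Finset ι} (hTF : T ⊆ F) (t : ℕ)
    (P : ℕ → ℕ → Prop) (hPk : ∀ k k' j, k ≤ k' → P k j → P k' j) (hPj : ∀ k j j', j ≤ j' → P k j → P k j')
    {U : Set (Set ι)} (hU : IsUpperSet U) :
    0 ≤ sahiE3 (prodBernoulli p) {ω : Set ι | t ≤ (F.filter (· ∈ ω)).card} U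
      {ω : Set ι | P (T.filter (· ∈ ω)).card ((F \ T).filter (· ∈ ω)).card} := by
  have hB := isUpperSet_twoBlock T (F \ T) P hPk hPj
  rw [← osT_ind_ind, osT_eq_osMp_add_osN]
  exact add_nonneg (osMp_threshold_nonneg_all p F t hU hB) (osN_twoBlock_nonneg p F hTF t P hPk hPj hU)

/-- The same with the two slots exchanged (`osN` is symmetric). [this work] -/
theorem osN_twoBlock_nonneg' (p : ι → unitInterval) (F : Finset ι) {T : Finset ι} (hTF : T ⊆ F) (t : ℕ)
    (P : ℕ → ℕ → Prop) (hPk : ∀ k k' j, k ≤ k' → P k j → P k' j) (hPj : ∀ k j j', j ≤ j' → P k j → P k j')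
    {U : Set (Set ι)} (hU : IsUpperSet U) :
    0 ≤ osN p {ω : Set ι | t ≤ (F.filter (· ∈ ω)).card}
      (ind {ω : Set ι | P (T.filter (· ∈ ω)).card ((F \ T).filter (· ∈ ω)).card}) (ind U) := by
  rw [osN_comm]; exact osN_twoBlock_nonneg p F hTF t P hPk hPj hU

/-- **KAHN C5 / SAHI `C₃`**, slots exchanged: `0 ≤ E₃(1_{N_F ≥ t}, 1_{P(N_T, N_{F∖T})}, 1_U)`. [this work] -/
theorem sahiE3_threshold_twoBlock_nonneg' (p : ι → unitInterval) (F : Finset ι) {T : Finset ι} (hTF : T ⊆ F) (t : ℕ)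
    (P : ℕ → ℕ → Prop) (hPk : ∀ k k' j, k ≤ k' → P k j → P k' j) (hPj : ∀ k j j', j ≤ j' → P k j → P k j')
    {U : Set (Set ι)} (hU : IsUpperSet U) :
    0 ≤ sahiE3 (prodBernoulli p) {ω : Set ι | t ≤ (F.filter (· ∈ ω)).card}
      {ω : Set ι | P (T.filter (· ∈ ω)).card ((F \ T).filter (· ∈ ω)).card} U := by
  have hB := isUpperSet_twoBlock T (F \ T) P hPk hPj
  rw [← osT_ind_ind, osT_eq_osMp_add_osN]
  exact add_nonneg (osMp_threshold_nonneg_all p F t hB hU) (osN_twoBlock_nonneg' p F hTF t P hPk hPj hU)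

end SahiOneStep

end Summit.CriticalPhenomena.PercolationContinuityZ3.Theorems
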